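import Literature.Algebra.Homology.ExtOfAcyclicResolutionFunctoriality
import Mathlib.Algebra.Homology.ShortComplex.ModuleCat
import HarnessLib

/-!
# Injectivity and surjectivity on homology, elementwise (Weibel, §1.1: classes are cocycles modulo coboundaries)

Layer `Algebra/Homology` (pure homological algebra; THEOREMS only: no definition, no instance, no notation, no named fact,
no `sorry`).  Cell `hodgecm-mathlib` FLOOR 0, P1 sub-line F-11, packet (iv)∕J3, letter **(G5-c)** «the refinement map is
bijective» (F0P1b-plan (g0) (R76); B-p01 (g17)) — the generic glue between the tree's two currencies for Čech cohomology:
CLASS level (`HomologicalComplex.homologyMap`) and COCHAIN level (cocycles and coboundaries).  HC_CM is proved only modulo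
the 7 printed citations until rung 0 closes — nothing here bears on a summit statement.

* §1 (`ℕ`-indexed cochain complexes of abelian groups, the currency of `Hom(𝒪_X, Č•(𝓤, M))` — ★ `AcyclicResolution.extComplex`):
  for a cochain map `ψ : K ⟶ K'`, **`exists_d_eq_of_homologyMap_injective`** unpacks the injectivity of `Hʲ(ψ)` («a cocycle
  whose image is a coboundary is a coboundary») and **`exists_eq_add_d_of_homologyMap_surjective`** unpacks the surjectivity
  («every cocycle of `K'` is the image of a cocycle of `K` up to a coboundary»), through the `ker ⧸ Im` model
  ★ `AcyclicResolution.homologyMap_concreteOf` (Mathlib `ShortComplex.abHomologyIso`).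
* §2 (`ℤ`-indexed cochain complexes of modules, the currency of ★ `OrderedCech.sysComplex` ∕ ★ `Modules.cechComplex`): for a
  cochain map `F : L ⟶ L'`, **`homologyMap_injective_of_elementwise`**, **`homologyMap_surjective_of_elementwise`** and
  **`homologyMap_bijective_of_elementwise`** repack the two elementwise statements into `Function.Injective ∕ Surjective ∕
  Bijective ⇑(HomologicalComplex.homologyMap F j).hom` (Mathlib `ShortComplex.moduleCatCyclesIso` ∕ `moduleCatHomologyIso`,
  `HomologicalComplex.toCycles`, `homologyπ_naturality`).

## References
* C. A. Weibel, *An introduction to homological algebra*, CUP (1994), §1.1 (Def. 1.1.1, Ex. 1.1.2), §1.2. [Weibel1994]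
-/

noncomputable section

universe w v v'

open CategoryTheory CategoryTheory.Limits

namespace Literature.Algebra.Homology

namespace HomologyElementwise

/-! ## §1 `ℕ`-indexed complexes of abelian groups: unpacking injectivity and surjectivity of `Hʲ(ψ)` -/

section Ab

variable {K K' : CochainComplex AddCommGrpCat.{w} ℕ} (ψ : K ⟶ K') (i j k : ℕ)

/-- **Injectivity of `Hʲ(ψ)`, elementwise**: if `Hʲ(ψ)` is injective, a `j`-cocycle `x` of `K` whose image `ψ x` is a
coboundary `d y` of `K'` is a coboundary `d w` of `K` (degrees `i = prev j`, `k = next j`; for `j = 0`, `i = 0` and the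
only "coboundary" is `0`). [cite: Weibel1994, §1.1 (Def. 1.1.1, Ex. 1.1.2)] -/
theorem exists_d_eq_of_homologyMap_injective
    (hi : (ComplexShape.up ℕ).prev j = i) (hk : (ComplexShape.up ℕ).next j = k)
    (hinj : Function.Injective (HomologicalComplex.homologyMap ψ j).hom)
    (x : K.X j) (hx : (K.d j k).hom x = 0) (y : K'.X i) (hy : (ψ.f j).hom x = (K'.d i j).hom y) :
    ∃ w : K.X i, (K.d i j).hom w = x := by
  -- the `ker ⧸ Im` models of `Hʲ(K)`, `Hʲ(K')`
  let e := K.homologyIsoSc' i j k hi hk ≪≫ ShortComplex.abHomologyIso _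
  let e' := K'.homologyIsoSc' i j k hi hk ≪≫ ShortComplex.abHomologyIso _
  have hconc := AcyclicResolution.homologyMap_concreteOf ψ i j k hi hk
  -- the class of `x` dies under `ψ`
  let xK : AddMonoidHom.ker (K.sc' i j k).g.hom := ⟨x, hx⟩
  have hq0 : AcyclicResolution.kerQuotMapOf ψ i j k (QuotientAddGroup.mk xK) = 0 := by
    change QuotientAddGroup.mk (AcyclicResolution.kerMapOf ψ i j k xK) = (0 : _ ⧸ _)
    rw [QuotientAddGroup.eq_zero_iff]
    refine ⟨y, Subtype.ext ?_⟩
    rw [ShortComplex.abToCycles_apply_coe, AcyclicResolution.kerMapOf_apply_val]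
    exact hy.symm
  have hcl : e.inv.hom (QuotientAddGroup.mk xK) = 0 := by
    apply hinj
    rw [map_zero]
    have h1 : e'.hom.hom ((HomologicalComplex.homologyMap ψ j).hom (e.inv.hom (QuotientAddGroup.mk xK))) = 0 := by
      change (HomologicalComplex.homologyMap ψ j ≫ e'.hom).hom (e.inv.hom (QuotientAddGroup.mk xK)) = 0
      rw [hconc]
      change AcyclicResolution.kerQuotMapOf ψ i j k ((e.inv ≫ e.hom).hom (QuotientAddGroup.mk xK)) = 0
      rw [Iso.inv_hom_id]
      exact hq0
    have h2 := congrArg e'.inv.hom h1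
    rw [map_zero, ← CategoryTheory.comp_apply, Iso.hom_inv_id] at h2
    exact h2
  have hmk : (QuotientAddGroup.mk xK : _ ⧸ (K.sc' i j k).abToCycles.range) = 0 := by
    have h3 := congrArg e.hom.hom hcl
    rw [map_zero, ← CategoryTheory.comp_apply, Iso.inv_hom_id] at h3
    exact h3
  rw [QuotientAddGroup.eq_zero_iff] at hmk
  obtain ⟨w, hw⟩ := hmk
  refine ⟨w, ?_⟩
  have := congrArg Subtype.val hw
  rw [ShortComplex.abToCycles_apply_coe] at this
  exact this

/-- **Surjectivity of `Hʲ(ψ)`, elementwise**: if `Hʲ(ψ)` is surjective, every `j`-cocycle `x'` of `K'` is `ψ x + d y` for a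
`j`-cocycle `x` of `K` and a cochain `y` of `K'` (degrees `i = prev j`, `k = next j`).
[cite: Weibel1994, §1.1 (Def. 1.1.1, Ex. 1.1.2)] -/
theorem exists_eq_add_d_of_homologyMap_surjective
    (hi : (ComplexShape.up ℕ).prev j = i) (hk : (ComplexShape.up ℕ).next j = k)
    (hsurj : Function.Surjective (HomologicalComplex.homologyMap ψ j).hom)
    (x' : K'.X j) (hx' : (K'.d j k).hom x' = 0) :
    ∃ (x : K.X j) (y : K'.X i), (K.d j k).hom x = 0 ∧ (ψ.f j).hom x = x' + (K'.d i j).hom y := by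
  let e := K.homologyIsoSc' i j k hi hk ≪≫ ShortComplex.abHomologyIso _
  let e' := K'.homologyIsoSc' i j k hi hk ≪≫ ShortComplex.abHomologyIso _
  have hconc := AcyclicResolution.homologyMap_concreteOf ψ i j k hi hk
  -- the class of `x'` and a preimage class, represented by a cocycle `xK`
  let xK' : AddMonoidHom.ker (K'.sc' i j k).g.hom := ⟨x', hx'⟩
  obtain ⟨p, hp⟩ := hsurj (e'.inv.hom (QuotientAddGroup.mk xK'))
  obtain ⟨q, hq⟩ : ∃ q, e.inv.hom q = p :=
    ⟨e.hom.hom p, by rw [← CategoryTheory.comp_apply, Iso.hom_inv_id]; rfl⟩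
  obtain ⟨xK, rfl⟩ := QuotientAddGroup.mk_surjective q
  -- compute the image class in the model of `Hʲ(K')` in two ways
  have h1 : e'.hom.hom ((HomologicalComplex.homologyMap ψ j).hom (e.inv.hom (QuotientAddGroup.mk xK))) =
      AcyclicResolution.kerQuotMapOf ψ i j k (QuotientAddGroup.mk xK) := by
    change (HomologicalComplex.homologyMap ψ j ≫ e'.hom).hom (e.inv.hom (QuotientAddGroup.mk xK)) = _
    rw [hconc]
    change AcyclicResolution.kerQuotMapOf ψ i j k ((e.inv ≫ e.hom).hom (QuotientAddGroup.mk xK)) = _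
    rw [Iso.inv_hom_id]
    rfl
  have h2 : e'.hom.hom ((HomologicalComplex.homologyMap ψ j).hom (e.inv.hom (QuotientAddGroup.mk xK))) =
      QuotientAddGroup.mk xK' := by
    rw [hq, hp, ← CategoryTheory.comp_apply, Iso.inv_hom_id]
    rfl
  have h3 : (QuotientAddGroup.mk (AcyclicResolution.kerMapOf ψ i j k xK) :
      _ ⧸ (K'.sc' i j k).abToCycles.range) = QuotientAddGroup.mk xK' := by
    rw [← h2, h1]
    rfl
  rw [QuotientAddGroup.eq_iff_sub_mem] at h3
  obtain ⟨y, hy⟩ := h3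
  have hyv : (K'.d i j).hom y = (ψ.f j).hom xK.1 - x' := by
    have := congrArg Subtype.val hy
    rw [ShortComplex.abToCycles_apply_coe, AddSubgroupClass.coe_sub, AcyclicResolution.kerMapOf_apply_val] at this
    exact this
  refine ⟨xK.1, y, xK.2, ?_⟩
  rw [hyv, add_sub_cancel]

end Ab

/-! ## §2 `ℤ`-indexed complexes of modules: repacking elementwise statements into `Hʲ(F)` -/

section ModuleCat

variable {A : Type v'} [Ring A] {L L' : CochainComplex (ModuleCat.{v} A) ℤ} (F : L ⟶ L') (j : ℤ)

/-- Classes are represented by cocycles (`π` is onto). [cite: Weibel1994, §1.1 (Def. 1.1.1)] -/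
theorem homologyπ_surjective (L : CochainComplex (ModuleCat.{v} A) ℤ) (j : ℤ) :
    Function.Surjective (L.homologyπ j).hom :=
  (ModuleCat.epi_iff_surjective _).1 inferInstance

/-- Cycles with the same underlying cochain are equal (`ι` is a monomorphism). [cite: Weibel1994, §1.1 (Def. 1.1.1)] -/
theorem cycles_ext (L : CochainComplex (ModuleCat.{v} A) ℤ) (j : ℤ) {z z' : L.cycles j}
    (h : (L.iCycles j).hom z = (L.iCycles j).hom z') : z = z' :=
  (ModuleCat.mono_iff_injective _).1 inferInstance h

/-- The underlying cochain of a cycle is a cocycle. [cite: Weibel1994, §1.1 (Def. 1.1.1)] -/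
theorem d_iCycles (L : CochainComplex (ModuleCat.{v} A) ℤ) (j : ℤ) (z : L.cycles j) :
    (L.d j (j + 1)).hom ((L.iCycles j).hom z) = 0 := by
  have h := L.iCycles_d j (j + 1)
  exact congrArg (fun f => f.hom z) h

/-- **A cocycle is a cycle**: an element `x` with `d x = 0` underlies a (unique) cycle. [cite: Weibel1994, §1.1 (Def. 1.1.1)] -/
theorem exists_cycles_of_d_eq_zero (L : CochainComplex (ModuleCat.{v} A) ℤ) (j : ℤ) (x : L.X j)
    (hx : (L.d j (j + 1)).hom x = 0) : ∃ z : L.cycles j, (L.iCycles j).hom z = x := by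
  have hx' : (L.sc j).g.hom x = 0 := by
    change (L.d j ((ComplexShape.up ℤ).next j)).hom x = 0
    rw [CochainComplex.next]
    exact hx
  refine ⟨((L.sc j).moduleCatCyclesIso.inv).hom ⟨x, hx'⟩, ?_⟩
  have h : ((L.sc j).moduleCatCyclesIso.inv ≫ (L.sc j).iCycles).hom ⟨x, hx'⟩ =
      ((L.sc j).moduleCatLeftHomologyData.i).hom ⟨x, hx'⟩ := by
    rw [ShortComplex.moduleCatCyclesIso_inv_iCycles (L.sc j)]
  exact h

/-- **A cycle whose class vanishes is a boundary** (through Mathlib's `ker ⧸ Im` model of the homology of a complex of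
modules). [cite: Weibel1994, §1.1 (Def. 1.1.1)] -/
theorem exists_d_eq_iCycles_of_homologyπ_eq_zero (L : CochainComplex (ModuleCat.{v} A) ℤ) (j : ℤ) (z : L.cycles j)
    (hz : (L.homologyπ j).hom z = 0) : ∃ y : L.X (j - 1), (L.d (j - 1) j).hom y = (L.iCycles j).hom z := by
  -- in the model `ker ⧸ Im`: the class of `z` is `mkQ` of the concrete cycle `cyclesIso z`
  have hπ : ((L.sc j).moduleCatLeftHomologyData.π).hom (((L.sc j).moduleCatCyclesIso.hom).hom z) = 0 := by
    have h' : ((L.sc j).homologyπ ≫ (L.sc j).moduleCatHomologyIso.hom).hom z =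
        ((L.sc j).moduleCatCyclesIso.hom ≫ (L.sc j).moduleCatLeftHomologyData.π).hom z := by
      rw [ShortComplex.π_moduleCatCyclesIso_hom (L.sc j)]
    change ((L.sc j).moduleCatHomologyIso.hom).hom (((L.sc j).homologyπ).hom z) =
      ((L.sc j).moduleCatLeftHomologyData.π).hom (((L.sc j).moduleCatCyclesIso.hom).hom z) at h'
    rw [← h']
    have hz' : ((L.sc j).homologyπ).hom z = 0 := hz
    rw [hz', map_zero]
  change (LinearMap.range (L.sc j).moduleCatToCycles).mkQ (((L.sc j).moduleCatCyclesIso.hom).hom z) = 0 at hπ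
  rw [Submodule.mkQ_apply, Submodule.Quotient.mk_eq_zero, LinearMap.mem_range] at hπ
  obtain ⟨y, hy⟩ := hπ
  -- `y : L.X (prev j)` with `d y = i z`; move it to degree `j - 1`
  have hy' : (L.d ((ComplexShape.up ℤ).prev j) j).hom y = (L.iCycles j).hom z := by
    have h := congrArg Subtype.val hy
    have hi' : (((L.sc j).moduleCatCyclesIso.hom ≫ (L.sc j).moduleCatLeftHomologyData.i).hom z : L.X j) =
        ((L.sc j).iCycles).hom z := by
      rw [ShortComplex.moduleCatCyclesIso_hom_i (L.sc j)]
    exact h.trans hi'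
  refine ⟨(L.XIsoOfEq (CochainComplex.prev ℤ j)).hom.hom y, ?_⟩
  rw [← hy', ← CategoryTheory.comp_apply, HomologicalComplex.XIsoOfEq_hom_comp_d]

/-- **A boundary has class zero.** [cite: Weibel1994, §1.1 (Def. 1.1.1)] -/
theorem homologyπ_eq_zero_of_d_eq_iCycles (L : CochainComplex (ModuleCat.{v} A) ℤ) (i j : ℤ) (z : L.cycles j)
    (y : L.X i) (hy : (L.d i j).hom y = (L.iCycles j).hom z) : (L.homologyπ j).hom z = 0 := by
  have hz : z = (L.toCycles i j).hom y := by
    apply cycles_ext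
    rw [← hy, ← CategoryTheory.comp_apply, HomologicalComplex.toCycles_i]
  rw [hz, ← CategoryTheory.comp_apply, HomologicalComplex.toCycles_comp_homologyπ]
  rfl

/-- **`Hʲ(F)` is injective if it is so elementwise**: whenever a `j`-cocycle `x` of `L` has image `F x = d y'` a coboundary of
`L'`, `x = d y` is a coboundary of `L`. [cite: Weibel1994, §1.1 (Ex. 1.1.2)] -/
theorem homologyMap_injective_of_elementwise
    (h : ∀ x : L.X j, (L.d j (j + 1)).hom x = 0 →
      (∃ y' : L'.X (j - 1), (L'.d (j - 1) j).hom y' = (F.f j).hom x) → ∃ y : L.X (j - 1), (L.d (j - 1) j).hom y = x) :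
    Function.Injective (HomologicalComplex.homologyMap F j).hom := by
  rw [injective_iff_map_eq_zero]
  intro a ha
  obtain ⟨z, rfl⟩ := homologyπ_surjective L j a
  -- the image class is the class of `cyclesMap F z`
  have hπ' : (L'.homologyπ j).hom (HomologicalComplex.cyclesMap F j z) = 0 := by
    rw [← CategoryTheory.comp_apply, ← HomologicalComplex.homologyπ_naturality, CategoryTheory.comp_apply]
    exact ha
  obtain ⟨y', hy'⟩ := exists_d_eq_iCycles_of_homologyπ_eq_zero L' j _ hπ'
  rw [← CategoryTheory.comp_apply, HomologicalComplex.cyclesMap_i, CategoryTheory.comp_apply] at hy'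
  obtain ⟨y, hy⟩ := h ((L.iCycles j).hom z) (d_iCycles L j z) ⟨y', hy'⟩
  exact homologyπ_eq_zero_of_d_eq_iCycles L (j - 1) j z y hy

/-- **`Hʲ(F)` is surjective if it is so elementwise**: whenever every `j`-cocycle `x'` of `L'` is `F x + d y'` for a
`j`-cocycle `x` of `L`. [cite: Weibel1994, §1.1 (Ex. 1.1.2)] -/
theorem homologyMap_surjective_of_elementwise
    (h : ∀ x' : L'.X j, (L'.d j (j + 1)).hom x' = 0 →
      ∃ (x : L.X j) (y' : L'.X (j - 1)), (L.d j (j + 1)).hom x = 0 ∧ (F.f j).hom x = x' + (L'.d (j - 1) j).hom y') :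
    Function.Surjective (HomologicalComplex.homologyMap F j).hom := by
  intro b
  obtain ⟨z', rfl⟩ := homologyπ_surjective L' j b
  obtain ⟨x, y', hx, hF⟩ := h ((L'.iCycles j).hom z') (d_iCycles L' j z')
  obtain ⟨z, hz⟩ := exists_cycles_of_d_eq_zero L j x hx
  refine ⟨(L.homologyπ j).hom z, ?_⟩
  rw [← CategoryTheory.comp_apply, HomologicalComplex.homologyπ_naturality, CategoryTheory.comp_apply]
  -- `cyclesMap F z - z'` is the boundary `d y'`
  have hdiff : (L'.homologyπ j).hom (HomologicalComplex.cyclesMap F j z - z') = 0 := by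
    refine homologyπ_eq_zero_of_d_eq_iCycles L' (j - 1) j _ y' ?_
    rw [map_sub, ← CategoryTheory.comp_apply, HomologicalComplex.cyclesMap_i, CategoryTheory.comp_apply, hz, hF,
      add_sub_cancel_left]
  rwa [map_sub, sub_eq_zero] at hdiff

/-- **`Hʲ(F)` is bijective if it is injective and surjective elementwise.** [cite: Weibel1994, §1.1 (Ex. 1.1.2)] -/
theorem homologyMap_bijective_of_elementwise
    (hinj : ∀ x : L.X j, (L.d j (j + 1)).hom x = 0 →
      (∃ y' : L'.X (j - 1), (L'.d (j - 1) j).hom y' = (F.f j).hom x) → ∃ y : L.X (j - 1), (L.d (j - 1) j).hom y = x)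
    (hsurj : ∀ x' : L'.X j, (L'.d j (j + 1)).hom x' = 0 →
      ∃ (x : L.X j) (y' : L'.X (j - 1)), (L.d j (j + 1)).hom x = 0 ∧ (F.f j).hom x = x' + (L'.d (j - 1) j).hom y') :
    Function.Bijective (HomologicalComplex.homologyMap F j).hom :=
  ⟨homologyMap_injective_of_elementwise F j hinj, homologyMap_surjective_of_elementwise F j hsurj⟩

end ModuleCat

end HomologyElementwise

end Literature.Algebra.Homology

end
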